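import Summits.HodgeConjecture.HodgeConjecture.Theses.TropicalKugaSatakeCayley
import Literature.Geometry.Kaehler.ComplexTorusHodge
import Mathlib

/-!
# Route `TropicalKugaSatakeCayley`, crux K2 `KontsevichTransferKS` (stmt-HodgeConjecture-18570), line `birth`,
# STUB 2 `stub_noWeightDrop` — part 2: weight-zero forms with vanishing tropical block are zero

Pure multilinear algebra on `Λ_ℝ = ℝ⁸_x ⊕ ℝ⁸_y` (lattice basis `e_j = Pi.single (inl j) 1`,
`f_j = Pi.single (inr j) 1`). For a constant complex `12`-form `ω` with `D_H ω = 0` for the weight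
operator `H(x, y) = (x, -y)` (`Σᵢ ω(w₁, …, H wᵢ, …, w₁₂) = 0` for all tuples `w`): on a tuple of lattice
basis vectors `D_H ω = (#x - #y) · ω` (`ktks_weight_sum_smul`, `ktks_sum_sign_eq`), so `ω` vanishes on
unbalanced tuples; a balanced injective tuple (six `x`-, six `y`-vectors) is a permutation of one of the
tuples `(f_{I'}, e_{J'})` (`I'`, `J'` complements of `2`-subsets `I`, `J ⊆ Fin 8`, increasing order) read
by the tropical `(6,6)`-block of the skeleton `Cruxes/KontsevichTransferKS/Lines/birth.lean`
(`tropProj ω I J = ω (latticeTuple I J)`), so if that block vanishes then `ω` vanishes on all tuples of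
distinct basis vectors and `ω = 0` (`Module.Basis.ext_alternating`, `AlternatingMap.map_perm`):
`ktks_eq_zero_of_weight_of_trop`. Theorems only: no definition, no named fact, no sorry.

## References

* [MikhalkinZharkov2014Eigenwave] G. Mikhalkin, I. Zharkov, Tropical eigenwave and intermediate
  Jacobians (2014), §6.1–6.2 (tropical `(p,p)`-coordinates).
* [LangeBirkenhake1992] H. Lange, Ch. Birkenhake, Complex Abelian Varieties (1992), §1.1.3
  (`Altⁿ(Λ, ℤ) = ⋀ⁿ Hom(Λ, ℤ)` and its monomial basis).
-/

noncomputable section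

set_option linter.dupNamespace false

namespace Summit.HodgeConjecture.HodgeConjecture.Theorems

open Literature.AlgebraicGeometry.Tropical Literature.AlgebraicGeometry.Tropical.TropicalTorus
open Literature.Geometry.Kaehler

/-! ### §4 Weight zero + vanishing tropical block ⇒ zero -/

section Combinatorics

variable {V : Type*} [NormedAddCommGroup V] [NormedSpace ℝ V]

/-- **An alternating form vanishing on a tuple vanishes on every injective tuple with the same (or
smaller) set of entries** (the tuples differ by a permutation; `AlternatingMap.map_perm`). [folklore] -/
theorem ktks_apply_eq_zero_of_range_subset {n : ℕ} (ω : V [⋀^Fin n]→L[ℝ] ℂ) {u u' : Fin n → V}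
    (hu' : Function.Injective u') (h : Set.range u' ⊆ Set.range u) (h0 : ω u = 0) : ω u' = 0 := by
  classical
  have hex : ∀ i, ∃ j, u j = u' i := fun i => h ⟨i, rfl⟩
  choose f hf using hex
  have hfinj : Function.Injective f := by
    intro i i' hii'
    apply hu'
    rw [← hf i, ← hf i', hii']
  have hfbij : Function.Bijective f := Finite.injective_iff_bijective.1 hfinj
  have hu'eq : u' = u ∘ (Equiv.ofBijective f hfbij) := by
    funext i
    simp only [Function.comp_apply, Equiv.ofBijective_apply, hf]
  rw [hu'eq]
  have hperm := ω.toAlternatingMap.map_perm u (Equiv.ofBijective f hfbij)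
  rw [ContinuousAlternatingMap.coe_toAlternatingMap] at hperm
  rw [hperm, h0, smul_zero]

/-- The complement of a `2`-subset of `Fin 8` has six elements. [folklore] -/
theorem ktks_card_compl (I : Sub 8 2) : (Finset.univ \ I.1).card = 6 := by
  rw [Finset.card_sdiff_of_subset (Finset.subset_univ _), Finset.card_univ, Fintype.card_fin, I.2]

/-- The lattice basis vectors are weight vectors of `H(x, y) = (x, -y)`: weight `+1` on the `x`-block
(`Sum.inl`), `-1` on the `y`-block (`Sum.inr`). [folklore] -/
theorem ktks_weight_single (s : Fin 8 ⊕ Fin 8) :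
    (Sum.elim (fun j => (Pi.single s (1 : ℝ) : Fin 8 ⊕ Fin 8 → ℝ) (Sum.inl j))
        (fun j => -(Pi.single s (1 : ℝ) : Fin 8 ⊕ Fin 8 → ℝ) (Sum.inr j)) : Fin 8 ⊕ Fin 8 → ℝ) =
      (Sum.elim (fun _ : Fin 8 => (1 : ℝ)) (fun _ : Fin 8 => (-1 : ℝ)) s) • (Pi.single s (1 : ℝ) : Fin 8 ⊕ Fin 8 → ℝ) := by
  funext t
  rcases s with a | a <;> rcases t with x | x <;> simp [Pi.single_apply]
  split_ifs <;> simp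

/-- **Weight count.** If `D_H ω = 0` then on a tuple of lattice basis vectors
`(#x-vectors - #y-vectors) · ω(tuple) = 0`. [folklore] -/
theorem ktks_weight_sum_smul (ω : (Fin 8 ⊕ Fin 8 → ℝ) [⋀^Fin (2 * 6)]→L[ℝ] ℂ)
    (hQ : ∀ w : Fin (2 * 6) → (Fin 8 ⊕ Fin 8 → ℝ), ∑ i, ω (Function.update w i ((fun x : Fin 8 ⊕ Fin 8 → ℝ => Sum.elim (fun j => x (Sum.inl j)) (fun j => -x (Sum.inr j))) (w i))) = 0)
    (v : Fin (2 * 6) → Fin 8 ⊕ Fin 8) :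
    (∑ i, Sum.elim (fun _ : Fin 8 => (1 : ℝ)) (fun _ : Fin 8 => (-1 : ℝ)) (v i)) • ω (fun i => (Pi.single (v i) (1 : ℝ) : Fin 8 ⊕ Fin 8 → ℝ)) = 0 := by
  classical
  have h := hQ (fun i => (Pi.single (v i) (1 : ℝ) : Fin 8 ⊕ Fin 8 → ℝ))
  simp only [] at h
  simp_rw [ktks_weight_single] at h
  have h' : ∀ i, ω (Function.update (fun i => (Pi.single (v i) (1 : ℝ) : Fin 8 ⊕ Fin 8 → ℝ)) i
      ((Sum.elim (fun _ : Fin 8 => (1 : ℝ)) (fun _ : Fin 8 => (-1 : ℝ)) (v i)) • (Pi.single (v i) (1 : ℝ) : Fin 8 ⊕ Fin 8 → ℝ))) =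
      (Sum.elim (fun _ : Fin 8 => (1 : ℝ)) (fun _ : Fin 8 => (-1 : ℝ)) (v i)) • ω (fun i => (Pi.single (v i) (1 : ℝ) : Fin 8 ⊕ Fin 8 → ℝ)) := by
    intro i
    rw [ω.map_update_smul]
    congr 1
    exact congrArg ω (Function.update_eq_self i _)
  simp_rw [h'] at h
  rw [← Finset.sum_smul] at h
  exact h

/-- **Sign count of an injective tuple of lattice basis indices**: `Σᵢ ε(vᵢ) = #A - #B` and
`#A + #B = 12`, where `A` (`B`) is the set of `x`- (`y`-) indices hit by `v`. [folklore] -/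
theorem ktks_sum_sign_eq (v : Fin (2 * 6) → Fin 8 ⊕ Fin 8) (hv : Function.Injective v) :
    (∑ i, Sum.elim (fun _ : Fin 8 => (1 : ℝ)) (fun _ : Fin 8 => (-1 : ℝ)) (v i)) =
      ((Finset.univ.filter (fun a : Fin 8 => Sum.inl a ∈ Finset.univ.image v)).card : ℝ) -
        ((Finset.univ.filter (fun a : Fin 8 => Sum.inr a ∈ Finset.univ.image v)).card : ℝ) ∧
    (Finset.univ.filter (fun a : Fin 8 => Sum.inl a ∈ Finset.univ.image v)).card +
        (Finset.univ.filter (fun a : Fin 8 => Sum.inr a ∈ Finset.univ.image v)).card = 2 * 6 := by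
  have key : ∀ g : Fin 8 ⊕ Fin 8 → ℝ, ∑ i, g (v i) =
      ∑ a : Fin 8, (if Sum.inl a ∈ Finset.univ.image v then g (Sum.inl a) else 0) +
        ∑ a : Fin 8, (if Sum.inr a ∈ Finset.univ.image v then g (Sum.inr a) else 0) := by
    intro g
    have h1 : ∑ i, g (v i) = ∑ s ∈ Finset.univ.image v, g s := by
      rw [Finset.sum_image (fun x _ y _ hxy => hv hxy)]
    have h2 : ∑ s ∈ Finset.univ.image v, g s =
        ∑ s, (if s ∈ Finset.univ.image v then g s else 0) := by
      rw [← Finset.sum_filter, Finset.filter_mem_eq_inter, Finset.univ_inter]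
    rw [h1, h2, Fintype.sum_sum_type]
  have hneg : ∀ a : Fin 8, (if Sum.inr a ∈ Finset.univ.image v then (Sum.elim (fun _ : Fin 8 => (1 : ℝ)) (fun _ : Fin 8 => (-1 : ℝ))) (Sum.inr a) else 0) =
      -(if Sum.inr a ∈ Finset.univ.image v then (1 : ℝ) else 0) := by
    intro a
    split_ifs <;> simp
  have hpos : ∀ a : Fin 8, (if Sum.inl a ∈ Finset.univ.image v then (Sum.elim (fun _ : Fin 8 => (1 : ℝ)) (fun _ : Fin 8 => (-1 : ℝ))) (Sum.inl a) else 0) =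
      (if Sum.inl a ∈ Finset.univ.image v then (1 : ℝ) else 0) := by
    intro a
    split_ifs <;> simp
  constructor
  · rw [key]
    simp_rw [hneg, hpos, Finset.sum_neg_distrib, Finset.sum_boole]
    ring
  · have h12 := key (fun _ => (1 : ℝ))
    rw [Finset.sum_const, Finset.card_univ, Fintype.card_fin] at h12
    simp only [Finset.sum_boole, nsmul_eq_mul, mul_one] at h12
    exact_mod_cast h12.symm

/-- **Weight zero and vanishing tropical block force `ω = 0`.** If `D_H ω = 0` (`H(x,y) = (x,-y)`)
and `ω` vanishes on the tuples `(f over (univ minus I), e over (univ minus J))` (`I`, `J` `2`-subsets of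
`Fin 8`, increasing order) — i.e. the tropical `(6,6)`-block of `ω` vanishes — then `ω = 0`: on a
tuple of basis vectors with unequal numbers of `x`- and `y`-vectors `ω` vanishes by the weight count,
and a balanced tuple is a permutation of one of the tuples read by the tropical block.
[cite: MikhalkinZharkov2014Eigenwave, §6.1–6.2] -/
theorem ktks_eq_zero_of_weight_of_trop (ω : (Fin 8 ⊕ Fin 8 → ℝ) [⋀^Fin (2 * 6)]→L[ℝ] ℂ)
    (hQ : ∀ w : Fin (2 * 6) → (Fin 8 ⊕ Fin 8 → ℝ), ∑ i, ω (Function.update w i ((fun x : Fin 8 ⊕ Fin 8 → ℝ => Sum.elim (fun j => x (Sum.inl j)) (fun j => -x (Sum.inr j))) (w i))) = 0)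
    (htrop : ∀ I J : Sub 8 2,
      ω (Fin.append (m := 6) (n := 6)
        (fun k => (Pi.single (Sum.inr ((Finset.univ \ I.1).orderEmbOfFin (ktks_card_compl I) k)) (1 : ℝ) :
          Fin 8 ⊕ Fin 8 → ℝ))
        (fun k => (Pi.single (Sum.inl ((Finset.univ \ J.1).orderEmbOfFin (ktks_card_compl J) k)) (1 : ℝ) :
          Fin 8 ⊕ Fin 8 → ℝ))) = 0) :
    ω = 0 := by
  apply ContinuousAlternatingMap.toAlternatingMap_injective
  rw [ContinuousAlternatingMap.toAlternatingMap_zero]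
  refine Module.Basis.ext_alternating (Pi.basisFun ℝ (Fin 8 ⊕ Fin 8)) fun v hv => ?_
  simp only [ContinuousAlternatingMap.coe_toAlternatingMap, AlternatingMap.zero_apply,
    Pi.basisFun_apply]
  have hW := ktks_weight_sum_smul ω hQ v
  rcases smul_eq_zero.1 hW with hsum0 | hω
  swap
  · exact hω
  obtain ⟨hdiff, hsum⟩ := ktks_sum_sign_eq v hv
  rw [hsum0] at hdiff
  set A : Finset (Fin 8) := Finset.univ.filter (fun a : Fin 8 => Sum.inl a ∈ Finset.univ.image v)
    with hA
  set B : Finset (Fin 8) := Finset.univ.filter (fun a : Fin 8 => Sum.inr a ∈ Finset.univ.image v)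
    with hB
  have hAB : A.card = B.card := by
    have : (A.card : ℝ) = B.card := by linarith
    exact_mod_cast this
  have hA6 : A.card = 6 := by omega
  have hB6 : B.card = 6 := by omega
  let I : Sub 8 2 := ⟨Finset.univ \ B, by
    rw [Finset.card_sdiff_of_subset (Finset.subset_univ _), Finset.card_univ, Fintype.card_fin, hB6]⟩
  let J : Sub 8 2 := ⟨Finset.univ \ A, by
    rw [Finset.card_sdiff_of_subset (Finset.subset_univ _), Finset.card_univ, Fintype.card_fin, hA6]⟩
  have hIc : Finset.univ \ I.1 = B := sdiff_sdiff_eq_self (Finset.subset_univ B)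
  have hJc : Finset.univ \ J.1 = A := sdiff_sdiff_eq_self (Finset.subset_univ A)
  refine ktks_apply_eq_zero_of_range_subset ω ?_ ?_ (htrop I J)
  · -- the tuple of distinct basis vectors is injective
    intro i i' hii'
    apply hv
    have h1 := congrFun hii' (v i)
    simp only [Pi.single_apply, if_true] at h1
    by_contra hne
    rw [if_neg hne] at h1
    exact one_ne_zero h1
  · rintro _ ⟨i, rfl⟩
    have hvi : v i ∈ Finset.univ.image v := Finset.mem_image_of_mem v (Finset.mem_univ i)
    rcases hs : v i with a | a
    · -- an `x`-vector: it sits in the `e`-block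
      have ha : a ∈ Finset.univ \ J.1 := by
        rw [hJc, hA, Finset.mem_filter, ← hs]
        exact ⟨Finset.mem_univ _, hvi⟩
      have ha' : a ∈ Set.range ((Finset.univ \ J.1).orderEmbOfFin (ktks_card_compl J)) := by
        rw [Finset.range_orderEmbOfFin]
        exact ha
      obtain ⟨k, hk⟩ := ha'
      exact ⟨Fin.natAdd 6 k, by simp only [Fin.append_right, hk, hs]⟩
    · -- a `y`-vector: it sits in the `f`-block
      have ha : a ∈ Finset.univ \ I.1 := by
        rw [hIc, hB, Finset.mem_filter, ← hs]
        exact ⟨Finset.mem_univ _, hvi⟩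
      have ha' : a ∈ Set.range ((Finset.univ \ I.1).orderEmbOfFin (ktks_card_compl I)) := by
        rw [Finset.range_orderEmbOfFin]
        exact ha
      obtain ⟨k, hk⟩ := ha'
      exact ⟨Fin.castAdd 6 k, by simp only [Fin.append_left, hk, hs]⟩

end Combinatorics

end Summit.HodgeConjecture.HodgeConjecture.Theorems

end
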